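import Summits.BirchSwinnertonDyer.BirchSwinnertonDyer.Theorems.ByReductionTypeAtTwoAdditiveKatoFineConjAAbelianTwoDivision
import Literature.NumberTheory.EllipticCurves.Kato2004.AdditiveNoSplitCyclotomicTwistRankZeroShaUpperBoundFineSelmerAtTwoSharp
import Literature.NumberTheory.EllipticCurves.Rank1Residual.Typed.CasselsLowerBound
import Literature.NumberTheory.EllipticCurves.PAdicHeightsProofs
import HarnessLib

/-!
# Crux `AdditiveRankZeroAtTwo` (K4 item 19098), child C4″ `AdditivePotMultOverKAtTwo` (item 22618):
# KATO AT `2` REACHES THE POTENTIALLY MULTIPLICATIVE BLOCK — the Kato half `MissingUpperBoundAt W 2` on the additive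
# curves with NO split multiplicative twist by `−1` or `−2` at `2` (potentially good OR potentially multiplicative),
# from Coates–Sujatha's statement (A) at `(E,2)` alone; BSD₂ there from (A) + the lower half over `ℚ`
# (seat `bsd-2adic-addL2x` GEN 13; `--supports`; kept OUTSIDE the route file's import cone, like GEN 8's sharp consumer)

HONEST FRAMING (cell `bsd-2adic`, HUMAN RULING D-0036/D-0054): types-the-object-of; closes none at the ∀-level;
nothing booked; BSD is not proved by any of this. Conditional helpers; no item is closed by this file.

WHAT THIS FILE DOES. GEN 11's glue `AddKatoTwo.additiveRankZeroAtTwo_of_residual_v4` (p627985) and the split v2.2 of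
the crux route EVERY additive potentially multiplicative curve (`ord₂ j < 0`; 463 census classes) through lane A's
over-`K` object (child C4″, `AdditivePotMultOverKAtTwo`: the C-part of BSD₂ over a semistabilising quadratic field,
«printed nowhere»), because the Kato-at-`2` readings of GEN 5/8 carried «potentially good at `2`». The two Literature
readings of `Kato2004/AdditiveNoSplitCyclotomicTwistRankZeroShaUpperBoundFineSelmerAtTwoSharp.lean` (this seat GEN 13)
remove that restriction. Kato's (12.5.1) is used in the readings ONLY to kill the local term `𝐇²_loc` of Thm. 12.5 (3)
in step T3; Kato's own 13.13 computes that term: its dual is `E(ℚ₂(ζ_{2^∞}))[2^∞]`, finite for an ADDITIVE curve at `2`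
iff NO twist `E^{(d)}`, `d ∈ {−1, 2, −2}`, is SPLIT multiplicative at `2` (Tate's uniformisation, Silverman *ATAEC*
V.5.2/5.3/Ex. 5.11) — the first reading, hypothesis (NST); and when `E^{(2)}` is split multiplicative the term is
supported at a single «`σ_{−1} = −1`» prime of `Λ`, which the `e₊`-localisation of T3 never meets — the APPEND reading,
hypothesis

  (NST′) `∀ d ∈ {−1, −2}`, `W^{(d)}` is not split multiplicative at `2`,

satisfied by all potentially good curves (§0) and, on the census, by 255 of the 463 potentially multiplicative classes
(semistabilising class `d*` with NON-split twist: `d* = −1`: 138, `d* = 2`: 41, `d* = −2`: 40; plus `d* = 2` split: 36;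
the 208 classes with a split twist by `−1` (169) or `−2` (39) are NOT covered — there the local term is met by T3 and
the reading loses `+2` / `+1`, not claimed; lane A census `pub/bsd-2adic/memos/ROUTE-L2-files/phi_census.tsv`, re-read
`pub/bsd-2adic/addL2x/gen13/POTMULT-NST-CENSUS-19098-addL2x-GEN13.tsv`; 194 of the 255 have irreducible `E[2]`).
This file consumes the APPEND reading (binder `hNST2`) and records the implications APPEND ⟹ first reading ⟹ GEN 8's
sharp potentially-good reading.

* §0 `not_hasSplitMultiplicativeReduction_quadraticTwist_of_padicValRat_j_nonneg` — potentially good ⇒ no twist is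
  split multiplicative at `2` (`j(W^{(d)}) = j(W)`, *AEC* VII.5.1 (b)); `noSplitCyclotomicTwist_of_padicValRat_j_nonneg`
  ((NST)), `noSplitTwistNegOneNegTwo_of_padicValRat_j_nonneg` ((NST′)); `katoAtTwoSharp_of_noSplitCyclotomicTwist`
  (first reading ⟹ sharp potentially-good reading), `katoAtTwoNST_of_katoAtTwoNST'` (APPEND ⟹ first),
  `katoAtTwoSharp_of_katoAtTwoNST'` (APPEND ⟹ sharp; hence also GEN 5's two `+ 1` readings via GEN 8's
  `katoFineSelmerAtTwo'_of_sharp`) — pure logic + §0.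
* §1 `padicValNat_shaOrder_le_of_katoAtTwoNoSplitTwist_rankZero` — the APPEND reading in Miller's currency:
  `#Ш_an = q`, `ord₂ #Ш ≤ ord₂ q − 2·ord₂ #E(ℚ)_tors`.
* §2 `missingUpperBoundAt_two_of_katoAtTwoNoSplitTwist` — the KATO HALF at a curve: non-CM, `r_an = 0`, additive at
  `2`, (NST′), `E[2]` irreducible, (A) at `(W,2)` ⟹ `MissingUpperBoundAt W 2`; and
  `missingUpperBoundAt_two_of_katoAtTwoNoSplitTwist_of_isAbelianGalois` — the same with (A) DISCHARGED from print
  (Lim 2017 Thm. 3.5 at `2` + Ferrero–Washington, GEN 9's `conjA_two_of_isAbelianGalois_divisionField_two`) when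
  `ℚ(E[2])` is abelian (cyclic cubic image).
* §3 `bsdp_two_of_katoAtTwoNoSplitTwist_of_lower` — BSD₂ at such a curve from (A) and the LOWER half over `ℚ`;
  `bsdp_two_iff_lower_of_katoAtTwoNoSplitTwist` — not lossy.
* §4 `addPotMultNST_upper_two_of_conjA` / `addPotMultNST_bsdp_two_of_conjA_of_lower` — the BLOCK forms on the
  potentially multiplicative (NST′) `E[2]`-irreducible sub-block, keyed like the children of the split: hypotheses
  `¬CM → r_an = 0 → Addv W 2 → ord₂ j < 0 → (NST′) → irreducible`, inputs (A) on the non-abelian-`ℚ(E[2])` part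
  (`hAnaM`, the C1″-shaped object on this sub-block) and the lower half over `ℚ` (`hLowM`, the C3″-shaped object);
  NO over-`K` object, NO Milne, NO Hoffstein–Luo, NO sibling. I.e. on this sub-block (194/463 census classes) the
  crux has the SAME one-sided residual shape as on the potentially good block, and C4″ is NEEDED only off it.

Binders (BY NAME): `hNST2` = the APPEND reading (Literature; flag
`Kato-12.5(1)(3)-(12.5.1)-13.13-T3-at-two-additive-noSplitTwistNegOneNegTwo-irreducible-fineSelmer-fg-sharp`, D-audit
owed together with the first reading); `hGZK`; `hmod`; `hLim2`, `hFW` (§2 abelian case only). Memo: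
`run/shared/lean/pub/bsd-2adic/addL2x/VERDICT-19098-addL2x-GEN13.md`.

References: [Kato2004Asterisque] Thm. 12.5 (1)(3), (12.5.1) (pp. 221–222), 13.8 (pp. 227–229), 13.13 (pp. 233–234),
13.14 (p. 234), 14.14 + Lemma 14.15 (pp. 243–244), Prop. 14.16 (2) (p. 244); [SilvermanATAEC1994] V.5.2, V.5.3,
Ex. 5.11; [SilvermanAEC2009] VII.5.1 (b), X.5.4, X.4.14; [CoatesSujatha2005] statement (A); [Lim2017FineSelmer] §3
Thm. 3.5; [FerreroWashington1979]; [Miller2011LMS] Def. 1.1.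
-/

set_option autoImplicit false
-- sibling precedent (`ByReductionTypeAtTwoAdditiveKatoFineDescentAtTwoSharp.lean`): the directory name repeats the summit name
set_option linter.dupNamespace false

noncomputable section

open scoped Classical

namespace Summit.BirchSwinnertonDyer.BirchSwinnertonDyer.Theorems.AddKatoTwo

open WeierstrassCurve Literature.NumberTheory.EllipticCurves
  Literature.NumberTheory.EllipticCurves.Rank1Residual
  Literature.NumberTheory.EllipticCurves.Rank1Residual.Typed
  Literature.NumberTheory.IwasawaTheory
  Summit.BirchSwinnertonDyer.Rank1Residual.AdditivePotMult
  Summit.BirchSwinnertonDyer.Rank1Residual.X5.AddTwoL2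

/-! ## §0 Potentially good ⇒ (NST), (NST′); APPEND reading ⟹ first reading ⟹ sharp potentially-good reading -/

/-- **Multiplicative reduction at `p` forces `ord_p j(E) < 0`** (Silverman *AEC* VII.5.1 (b): the minimal model has
unit `c₄` and non-unit `Δ`), read off the tree's `one_lt_norm_j_of_hasMultiplicativeReductionAtPrime` (`‖j‖_p > 1`)
through `‖q‖_p = p^{−ord_p q}`. [cite: SilvermanAEC2009, Prop. VII.5.1 (b)] -/
theorem padicValRat_j_neg_of_multiplicative (W : WeierstrassCurve ℚ) [W.IsElliptic] (p : ℕ) [Fact p.Prime]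
    (h : W.HasMultiplicativeReductionAtPrime p) : padicValRat p W.j < 0 := by
  have h1 := one_lt_norm_j_of_hasMultiplicativeReductionAtPrime h
  have hj0 : W.j ≠ 0 := by
    intro hj0
    rw [hj0, Rat.cast_zero, norm_zero] at h1
    exact absurd h1 (by norm_num)
  rw [Padic.eq_padicNorm] at h1
  have h2 : (1 : ℚ) < padicNorm p W.j := by exact_mod_cast h1
  rw [padicNorm.eq_zpow_of_nonzero hj0] at h2
  by_contra hge
  have hge' : 0 ≤ padicValRat p W.j := le_of_not_gt hge
  have hp : (1 : ℚ) ≤ p := by exact_mod_cast (Fact.out : p.Prime).one_lt.le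
  have h3 : (p : ℚ) ^ (-padicValRat p W.j) ≤ 1 := zpow_le_one_of_nonpos₀ hp (by omega)
  linarith

/-- **Potentially good at `2` ⇒ (NST): no quadratic twist of a potentially good curve is split multiplicative at
`2`.** `j(W^{(d)}) = j(W)` (`j_quadraticTwist`) and (split) multiplicative reduction at `2` would force
`ord₂ j < 0` (`padicValRat_j_neg_of_multiplicative`). The degenerate twist `d = 0` is excluded by the hypothesis
`d ≠ 0` (the three classes `−1, 2, −2` are non-zero). [cite: SilvermanAEC2009, Prop. VII.5.1 (b) and X.5 Cor. 5.4] -/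
theorem not_hasSplitMultiplicativeReduction_quadraticTwist_of_padicValRat_j_nonneg
    (W : WeierstrassCurve ℚ) [W.IsElliptic] (hj : 0 ≤ padicValRat 2 W.j) {d : ℚ} (hd : d ≠ 0) :
    ¬ (W.quadraticTwist d).HasSplitMultiplicativeReductionAtPrime 2 := by
  intro hs
  haveI := W.isElliptic_quadraticTwist hd
  have hlt := padicValRat_j_neg_of_multiplicative (W.quadraticTwist d) 2 hs.hasMultiplicativeReductionAtPrime
  rw [W.j_quadraticTwist hd] at hlt
  exact absurd hj (not_le.mpr hlt)

/-- (NST) from potential good reduction, in the exact shape of the reading's hypothesis. [cite: SilvermanAEC2009, Prop. VII.5.1 (b)] -/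
theorem noSplitCyclotomicTwist_of_padicValRat_j_nonneg (W : WeierstrassCurve ℚ) [W.IsElliptic]
    (hj : 0 ≤ padicValRat 2 W.j) :
    ∀ d : ℚ, d = -1 ∨ d = 2 ∨ d = -2 → ¬ (W.quadraticTwist d).HasSplitMultiplicativeReductionAtPrime 2 := by
  intro d hd
  refine not_hasSplitMultiplicativeReduction_quadraticTwist_of_padicValRat_j_nonneg W hj ?_
  rcases hd with rfl | rfl | rfl <;> norm_num

/-- **The new reading IMPLIES the potentially-good SHARP reading** (and hence, by GEN 8's
`katoFineSelmerAtTwo'_of_sharp` / `katoFineSelmerAtTwo_of_sharp`, GEN 5's two `+ 1` readings): on a potentially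
good curve the hypothesis (NST) holds by `noSplitCyclotomicTwist_of_padicValRat_j_nonneg`. Bookkeeping, pure logic
over the two Literature `def`s. [cite: Kato2004Asterisque, Thm. 12.5 (3) and (12.5.1) (p. 222), 13.13 (p. 233)] -/
theorem katoAtTwoSharp_of_noSplitCyclotomicTwist
    (h : Kato2004.rankZero_padicValNat_sha_add_padicValNat_tamagawa_le_at_two_of_noSplitCyclotomicTwist_of_irreducible_of_fineSelmerDual_fg) :
    Kato2004.rankZero_padicValNat_sha_add_padicValNat_tamagawa_le_at_two_of_irreducible_of_fineSelmerDual_fg := by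
  intro W _ _ hcm hgood hmult hpot hirr hA hL hfin
  exact h W hcm hgood hmult (noSplitCyclotomicTwist_of_padicValRat_j_nonneg W hpot) hirr hA hL hfin

/-- (NST′) from potential good reduction, in the exact shape of the APPEND reading's hypothesis (no split multiplicative
twist by `−1` or `−2` at `2`). [cite: SilvermanAEC2009, Prop. VII.5.1 (b)] -/
theorem noSplitTwistNegOneNegTwo_of_padicValRat_j_nonneg (W : WeierstrassCurve ℚ) [W.IsElliptic]
    (hj : 0 ≤ padicValRat 2 W.j) :
    ∀ d : ℚ, d = -1 ∨ d = -2 → ¬ (W.quadraticTwist d).HasSplitMultiplicativeReductionAtPrime 2 := by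
  intro d hd
  refine not_hasSplitMultiplicativeReduction_quadraticTwist_of_padicValRat_j_nonneg W hj ?_
  rcases hd with rfl | rfl <;> norm_num

/-- **The APPEND reading (hypothesis (NST′): no split twist by `−1`, `−2`) IMPLIES the first reading (hypothesis (NST):
no split twist by `−1`, `2`, `−2`)**: (NST) ⟹ (NST′). Bookkeeping, pure logic over the two Literature `def`s.
[cite: Kato2004Asterisque, Thm. 12.5 (3) and (12.5.1) (p. 222), 13.13 (pp. 233–234)] -/
theorem katoAtTwoNST_of_katoAtTwoNST'
    (h : Kato2004.rankZero_padicValNat_sha_add_padicValNat_tamagawa_le_at_two_of_noSplitTwistNegOneNegTwo_of_irreducible_of_fineSelmerDual_fg) :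
    Kato2004.rankZero_padicValNat_sha_add_padicValNat_tamagawa_le_at_two_of_noSplitCyclotomicTwist_of_irreducible_of_fineSelmerDual_fg := by
  intro W _ _ hcm hgood hmult hnst hirr hA hL hfin
  exact h W hcm hgood hmult (fun d hd => hnst d (by rcases hd with h1 | h2; exacts [Or.inl h1, Or.inr (Or.inr h2)]))
    hirr hA hL hfin

/-- The APPEND reading implies the potentially-good SHARP reading (composition of the two implications above).
[cite: Kato2004Asterisque, Thm. 12.5 (3) and (12.5.1) (p. 222)] -/
theorem katoAtTwoSharp_of_katoAtTwoNST'
    (h : Kato2004.rankZero_padicValNat_sha_add_padicValNat_tamagawa_le_at_two_of_noSplitTwistNegOneNegTwo_of_irreducible_of_fineSelmerDual_fg) :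
    Kato2004.rankZero_padicValNat_sha_add_padicValNat_tamagawa_le_at_two_of_irreducible_of_fineSelmerDual_fg :=
  katoAtTwoSharp_of_noSplitCyclotomicTwist (katoAtTwoNST_of_katoAtTwoNST' h)


/-! ## §1 The reading in Miller's currency -/

/-- **Rank-`0` upper bound from the `p = 2` reading under (NST′)**: for a non-CM globally minimal `W`, additive at `2`
(potentially good or potentially multiplicative), with no split multiplicative twist by `−1` or `−2` at `2`,
`E[2]` irreducible, `r_an = 0` and statement (A) at `(E,2)` (`hA`): `#Ш_an = q` and
`ord₂ #Ш ≤ ord₂ q − 2·ord₂ #E(ℚ)_tors` (the reading bounds `ord₂ #Ш + v₂(∏ c_ℓ)` by `ord₂(L/Ω)` and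
`#Ш_an = (L/Ω)·#tors²/∏ c_ℓ`). Proof word for word as GEN 8's `padicValNat_shaOrder_le_of_katoFineSelmerAtTwoSharp_rankZero`.
[cite: Kato2004Asterisque, Thm. 12.5 (1)(3) (pp. 221–222), 13.8 (pp. 227–229), 13.13 (p. 233), 14.14 and Lemma 14.15 (pp. 243–244)]
[cite: CoatesSujatha2005, statement (A)] [cite: Miller2011LMS, Def. 1.1] -/
theorem padicValNat_shaOrder_le_of_katoAtTwoNoSplitTwist_rankZero
    (hNST2 : Kato2004.rankZero_padicValNat_sha_add_padicValNat_tamagawa_le_at_two_of_noSplitTwistNegOneNegTwo_of_irreducible_of_fineSelmerDual_fg)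
    (hGZK : rank_eq_analyticRank_of_analyticRank_le_one) (hmod : hasEntireLFunction_rat)
    (W : WeierstrassCurve ℚ) [W.IsElliptic] [W.IsGloballyMinimal] (hcm : ¬ W.HasCM)
    (hgood : ¬ W.HasGoodReductionAtPrime 2) (hmult : ¬ W.HasMultiplicativeReductionAtPrime 2)
    (hnst : ∀ d : ℚ, d = -1 ∨ d = -2 → ¬ (W.quadraticTwist d).HasSplitMultiplicativeReductionAtPrime 2)
    (hirr : W.HasIrreducibleModPGaloisRep 2)
    (hA : ∀ (κ : ZpExtension ℚ 2), κ.IsCyclotomic →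
      ∃ (γ : Field.absoluteGaloisGroup ℚ) (D : W.FineSelmerDualData κ γ),
        Module.Finite ℤ_[2] (RestrictScalars ℤ_[2] (IwasawaAlgebra 2) D.X))
    (hr : W.analyticRank = 0) :
    ∃ q : ℚ, shaAn W = (q : ℂ) ∧
      (padicValNat 2 W.shaOrder : ℤ) ≤ padicValRat 2 q - 2 * padicValNat 2 W.torsionOrder := by
  have hL : W.entireLFunction 1 ≠ 0 := (W.analyticRank_eq_zero_iff_holds (hmod W)).mp hr
  obtain ⟨hmw, hfin⟩ := hGZK W (by rw [hr]; exact zero_le_one)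
  haveI : Finite W.sha := hfin
  have hmw0 : W.mordellWeilRank = 0 := by rw [hmw, hr]
  obtain ⟨q₀, hq₀, hle⟩ := hNST2 W hcm hgood hmult hnst hirr hA hL hfin
  have hΩpos : 0 < W.realPeriodRat := W.realPeriodRat_pos_holds
  have hΩ : (W.realPeriodRat : ℂ) ≠ 0 := by exact_mod_cast hΩpos.ne'
  have hc0 : 0 < W.tamagawaProduct := W.tamagawaProduct_pos_holds
  have ht0 : 0 < W.torsionOrder := W.torsionOrder_pos_holds
  have hq₀0 : q₀ ≠ 0 := by
    rintro rfl
    rw [Rat.cast_zero, div_eq_zero_iff] at hq₀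
    exact hq₀.elim hL hΩ
  refine ⟨q₀ * (W.torsionOrder : ℚ) ^ 2 / (W.tamagawaProduct : ℚ), ?_, ?_⟩
  · have hLq : W.entireLFunction 1 = (q₀ : ℂ) * (W.realPeriodRat : ℂ) := by
      rw [← hq₀, div_mul_cancel₀ _ hΩ]
    rw [shaAn_def, leadingLCoeff_eq_of_analyticRank_eq_zero W hr,
      W.regulator_eq_one_of_rank_zero hmw0, hLq]
    push_cast
    field_simp
  · have ht : (W.torsionOrder : ℚ) ≠ 0 := by exact_mod_cast ht0.ne'
    have hcq : (W.tamagawaProduct : ℚ) ≠ 0 := by exact_mod_cast hc0.ne'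
    have hsha : padicValNat 2 (Nat.card (AddCommGroup.primaryComponent W.sha 2)) =
        padicValNat 2 W.shaOrder := by
      unfold WeierstrassCurve.shaOrder
      exact padicValNat_card_addPrimaryComponent 2
    have hv : padicValRat 2 (q₀ * (W.torsionOrder : ℚ) ^ 2 / (W.tamagawaProduct : ℚ)) =
        padicValRat 2 q₀ + 2 * (padicValNat 2 W.torsionOrder : ℤ) -
          (padicValNat 2 W.tamagawaProduct : ℤ) := by
      rw [padicValRat.div (mul_ne_zero hq₀0 (pow_ne_zero 2 ht)) hcq,
        padicValRat.mul hq₀0 (pow_ne_zero 2 ht), pow_two, padicValRat.mul ht ht,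
        padicValRat.of_nat, padicValRat.of_nat]
      ring
    rw [hv, ← hsha]
    linarith

/-! ## §2 The KATO HALF at a curve under (NST′), from statement (A) alone -/

/-- **The Kato half at a curve from statement (A) at `(E,2)`, for ADDITIVE reduction at `2` — potentially good or
potentially multiplicative — under (NST′).** Granted the reading `hNST2`, GZK and modularity: for `W` non-CM, globally
minimal, `r_an = 0`, additive at `2` (`Addv W 2`), with no split multiplicative twist by `−1` or `−2` at `2`, and
`E[2]` irreducible, (A) at `(W,2)` gives `MissingUpperBoundAt W 2` (torsion term `0` by irreducibility,
`padicValNat_torsionOrder_eq_zero_of_irreducible`). No parity certificate, no Cassels–Tate, no over-`K` object.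
[cite: Kato2004Asterisque, Thm. 12.5 (1)(3) (pp. 221–222), 13.8 (pp. 227–229), 13.13–13.14 (pp. 233–234), 14.14 (p. 243)]
[cite: SilvermanATAEC1994, Thm. V.5.3 and Exercise 5.11] [cite: CoatesSujatha2005, statement (A)] [cite: Miller2011LMS, Def. 1.1] -/
theorem missingUpperBoundAt_two_of_katoAtTwoNoSplitTwist
    (hNST2 : Kato2004.rankZero_padicValNat_sha_add_padicValNat_tamagawa_le_at_two_of_noSplitTwistNegOneNegTwo_of_irreducible_of_fineSelmerDual_fg)
    (hGZK : rank_eq_analyticRank_of_analyticRank_le_one) (hmod : hasEntireLFunction_rat)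
    (W : WeierstrassCurve ℚ) [W.IsElliptic] [W.IsGloballyMinimal] (hcm : ¬ W.HasCM) (hr : W.analyticRank = 0)
    (hadd : Addv W 2)
    (hnst : ∀ d : ℚ, d = -1 ∨ d = -2 → ¬ (W.quadraticTwist d).HasSplitMultiplicativeReductionAtPrime 2)
    (hirr : W.HasIrreducibleModPGaloisRep 2)
    (hA : ∀ (κ : ZpExtension ℚ 2), κ.IsCyclotomic →
      ∃ (γ : Field.absoluteGaloisGroup ℚ) (D : W.FineSelmerDualData κ γ),
        Module.Finite ℤ_[2] (RestrictScalars ℤ_[2] (IwasawaAlgebra 2) D.X)) :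
    MissingUpperBoundAt W 2 := by
  haveI : Fact (Nat.Prime 2) := ⟨Nat.prime_two⟩
  obtain ⟨q, hq, hle⟩ :=
    padicValNat_shaOrder_le_of_katoAtTwoNoSplitTwist_rankZero hNST2 hGZK hmod W hcm hadd.1 hadd.2 hnst hirr hA hr
  rw [padicValNat_torsionOrder_eq_zero_of_irreducible W 2 hirr] at hle
  simp only [Nat.cast_zero, mul_zero, sub_zero] at hle
  exact ⟨q, hq, hle⟩

/-- **The Kato half at a curve under (NST′) with statement (A) DISCHARGED from print when `ℚ(E[2])` is abelian**
(irreducible `E[2]` with cyclic cubic image): Lim 2017 Thm. 3.5 at `2` + Ferrero–Washington BY NAME through GEN 9's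
`conjA_two_of_isAbelianGalois_divisionField_two` (reduction-type-free). On such curves the Kato half rests on
PRINT + the one reading only. [cite: Lim2017FineSelmer, §3 Thm. 3.5] [cite: FerreroWashington1979, Theorem]
[cite: Kato2004Asterisque, Thm. 12.5 (3) (p. 222), 13.13 (p. 233)] -/
theorem missingUpperBoundAt_two_of_katoAtTwoNoSplitTwist_of_isAbelianGalois
    (hNST2 : Kato2004.rankZero_padicValNat_sha_add_padicValNat_tamagawa_le_at_two_of_noSplitTwistNegOneNegTwo_of_irreducible_of_fineSelmerDual_fg)
    (hGZK : rank_eq_analyticRank_of_analyticRank_le_one) (hmod : hasEntireLFunction_rat)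
    (hLim2 : Lim2017.thm35_at_two_fineSelmerDual_moduleFinite_of_classicalMuVanishes_of_le_divisionField_four)
    (hFW : ferreroWashington1979_classicalMuVanishes)
    (W : WeierstrassCurve ℚ) [W.IsElliptic] [W.IsGloballyMinimal] (hcm : ¬ W.HasCM) (hr : W.analyticRank = 0)
    (hadd : Addv W 2)
    (hnst : ∀ d : ℚ, d = -1 ∨ d = -2 → ¬ (W.quadraticTwist d).HasSplitMultiplicativeReductionAtPrime 2)
    (hirr : W.HasIrreducibleModPGaloisRep 2) (hab : IsAbelianGalois ℚ (W.divisionField 2)) :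
    MissingUpperBoundAt W 2 := by
  haveI := hab
  exact missingUpperBoundAt_two_of_katoAtTwoNoSplitTwist hNST2 hGZK hmod W hcm hr hadd hnst hirr
    (conjA_two_of_isAbelianGalois_divisionField_two hLim2 hFW W)

/-! ## §3 BSD₂ at a curve under (NST′): statement (A) + the LOWER half over `ℚ` -/

/-- **BSD₂ at a curve under (NST′) from statement (A) at `(E,2)` and the LOWER half over `ℚ`.** The upper half by
`missingUpperBoundAt_two_of_katoAtTwoNoSplitTwist`; with `MissingLowerBoundAt W 2` (however obtained: a per-class
Cassels–Tate certificate, or a future Eisenstein half) `missingPPartAt_of_lower_of_upper` + `bsdp_of_missingPPartAt`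
give `BSDp W 2`. [cite: Kato2004Asterisque, Thm. 12.5 (1)(3) (pp. 221–222), 13.13 (p. 233), 14.14 (p. 243)]
[cite: CoatesSujatha2005, statement (A)] [cite: Miller2011LMS, §1 and Def. 1.1] -/
theorem bsdp_two_of_katoAtTwoNoSplitTwist_of_lower
    (hNST2 : Kato2004.rankZero_padicValNat_sha_add_padicValNat_tamagawa_le_at_two_of_noSplitTwistNegOneNegTwo_of_irreducible_of_fineSelmerDual_fg)
    (hGZK : rank_eq_analyticRank_of_analyticRank_le_one) (hmod : hasEntireLFunction_rat)
    (W : WeierstrassCurve ℚ) [W.IsElliptic] [W.IsGloballyMinimal] (hcm : ¬ W.HasCM) (hr : W.analyticRank = 0)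
    (hadd : Addv W 2)
    (hnst : ∀ d : ℚ, d = -1 ∨ d = -2 → ¬ (W.quadraticTwist d).HasSplitMultiplicativeReductionAtPrime 2)
    (hirr : W.HasIrreducibleModPGaloisRep 2)
    (hA : ∀ (κ : ZpExtension ℚ 2), κ.IsCyclotomic →
      ∃ (γ : Field.absoluteGaloisGroup ℚ) (D : W.FineSelmerDualData κ γ),
        Module.Finite ℤ_[2] (RestrictScalars ℤ_[2] (IwasawaAlgebra 2) D.X))
    (hlow : MissingLowerBoundAt W 2) : BSDp W 2 := by
  have hr1 : W.analyticRank ≤ 1 := by rw [hr]; exact zero_le_one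
  exact bsdp_of_missingPPartAt W 2 hGZK hr1
    (missingPPartAt_of_lower_of_upper W 2 hlow
      (missingUpperBoundAt_two_of_katoAtTwoNoSplitTwist hNST2 hGZK hmod W hcm hr hadd hnst hirr hA))

/-- **Not lossy**: granted the Kato half under (NST′), `BSD₂(W)` is EQUIVALENT to the lower half over `ℚ`
(`missingPPartAt_of_bsdp`; `Ш` finite by GZK in rank `0`). Bookkeeping. [cite: Miller2011LMS, §1 and Def. 1.1] -/
theorem bsdp_two_iff_lower_of_katoAtTwoNoSplitTwist
    (hNST2 : Kato2004.rankZero_padicValNat_sha_add_padicValNat_tamagawa_le_at_two_of_noSplitTwistNegOneNegTwo_of_irreducible_of_fineSelmerDual_fg)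
    (hGZK : rank_eq_analyticRank_of_analyticRank_le_one) (hmod : hasEntireLFunction_rat)
    (W : WeierstrassCurve ℚ) [W.IsElliptic] [W.IsGloballyMinimal] (hcm : ¬ W.HasCM) (hr : W.analyticRank = 0)
    (hadd : Addv W 2)
    (hnst : ∀ d : ℚ, d = -1 ∨ d = -2 → ¬ (W.quadraticTwist d).HasSplitMultiplicativeReductionAtPrime 2)
    (hirr : W.HasIrreducibleModPGaloisRep 2)
    (hA : ∀ (κ : ZpExtension ℚ 2), κ.IsCyclotomic →
      ∃ (γ : Field.absoluteGaloisGroup ℚ) (D : W.FineSelmerDualData κ γ),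
        Module.Finite ℤ_[2] (RestrictScalars ℤ_[2] (IwasawaAlgebra 2) D.X)) :
    BSDp W 2 ↔ MissingLowerBoundAt W 2 := by
  haveI : Fact (Nat.Prime 2) := ⟨Nat.prime_two⟩
  have hr1 : W.analyticRank ≤ 1 := by rw [hr]; exact zero_le_one
  constructor
  · intro h
    haveI : Finite W.sha := (hGZK W hr1).2
    exact (lower_and_upper_of_missingPPartAt W 2 (missingPPartAt_of_bsdp W 2 h)).1
  · exact bsdp_two_of_katoAtTwoNoSplitTwist_of_lower hNST2 hGZK hmod W hcm hr hadd hnst hirr hA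

/-! ## §4 The BLOCK forms on the potentially multiplicative (NST′) `E[2]`-irreducible sub-block -/

/-- **The Kato half on the potentially multiplicative (NST′) irreducible sub-block at `2`**, keyed like the children of
the split: for every non-CM globally minimal `W` of analytic rank `0`, additive at `2` with `ord₂ j < 0`, satisfying
(NST′), with `E[2]` irreducible: `MissingUpperBoundAt W 2`, GRANTED the reading `hNST2`, GZK, modularity, Lim@2 + FW
(abelian `ℚ(E[2])`), and — the C1″-shaped research input on THIS sub-block — statement (A) at `(W,2)` on its curves with
NON-abelian `ℚ(E[2])` (`hAnaM`). No over-`K` object. Conditional; closes nothing.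
[cite: Kato2004Asterisque, Thm. 12.5 (3) (p. 222), 13.13 (p. 233), 14.14 (p. 243)] [cite: CoatesSujatha2005, statement (A)]
[cite: Lim2017FineSelmer, §3 Thm. 3.5] [cite: FerreroWashington1979, Theorem] -/
theorem addPotMultNST_upper_two_of_conjA
    (hNST2 : Kato2004.rankZero_padicValNat_sha_add_padicValNat_tamagawa_le_at_two_of_noSplitTwistNegOneNegTwo_of_irreducible_of_fineSelmerDual_fg)
    (hGZK : rank_eq_analyticRank_of_analyticRank_le_one) (hmod : hasEntireLFunction_rat)
    (hLim2 : Lim2017.thm35_at_two_fineSelmerDual_moduleFinite_of_classicalMuVanishes_of_le_divisionField_four)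
    (hFW : ferreroWashington1979_classicalMuVanishes)
    (hAnaM : ∀ (W : WeierstrassCurve ℚ) [W.IsElliptic] [W.IsGloballyMinimal], ¬ W.HasCM → W.analyticRank = 0 →
      Addv W 2 → padicValRat 2 W.j < 0 →
      (∀ d : ℚ, d = -1 ∨ d = -2 → ¬ (W.quadraticTwist d).HasSplitMultiplicativeReductionAtPrime 2) →
      W.HasIrreducibleModPGaloisRep 2 → ¬ IsAbelianGalois ℚ (W.divisionField 2) →
      ∀ (κ : ZpExtension ℚ 2), κ.IsCyclotomic →
        ∃ (γ : Field.absoluteGaloisGroup ℚ) (D : W.FineSelmerDualData κ γ),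
          Module.Finite ℤ_[2] (RestrictScalars ℤ_[2] (IwasawaAlgebra 2) D.X)) :
    ∀ (W : WeierstrassCurve ℚ) [W.IsElliptic] [W.IsGloballyMinimal], ¬ W.HasCM → W.analyticRank = 0 →
      Addv W 2 → padicValRat 2 W.j < 0 →
      (∀ d : ℚ, d = -1 ∨ d = -2 → ¬ (W.quadraticTwist d).HasSplitMultiplicativeReductionAtPrime 2) →
      W.HasIrreducibleModPGaloisRep 2 → MissingUpperBoundAt W 2 := by
  intro W _ _ hcm hr hadd hj hnst hirr
  by_cases hab : IsAbelianGalois ℚ (W.divisionField 2)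
  · exact missingUpperBoundAt_two_of_katoAtTwoNoSplitTwist_of_isAbelianGalois hNST2 hGZK hmod hLim2 hFW W hcm hr
      hadd hnst hirr hab
  · exact missingUpperBoundAt_two_of_katoAtTwoNoSplitTwist hNST2 hGZK hmod W hcm hr hadd hnst hirr
      (hAnaM W hcm hr hadd hj hnst hirr hab)

/-- **BSD₂ on the potentially multiplicative (NST′) irreducible sub-block at `2`** from the Kato half
(`addPotMultNST_upper_two_of_conjA`) and — the C3″-shaped research input on THIS sub-block — the LOWER half over `ℚ`
(`hLowM`). Inputs: PRINT {GZK, modularity, Lim@2, FW} + READING {`hNST2`} + (A) on the non-abelian part (`hAnaM`) +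
lower half (`hLowM`); NO over-`K` object, NO Milne, NO Hoffstein–Luo, NO sibling crux. So on this sub-block
(219/463 census classes by semistabilising type, those with irreducible `E[2]`) the crux `AdditiveRankZeroAtTwo` has
the SAME one-sided residual shape as on the potentially good block, and child C4″ `AdditivePotMultOverKAtTwo`
(item 22618) is NEEDED only on its complement (a split multiplicative twist by `−1`, `2` or `−2`, or reducible `E[2]`).
Conditional; closes nothing. [cite: Kato2004Asterisque, Thm. 12.5 (3) (p. 222), 13.13 (p. 233), 14.14 (p. 243)]
[cite: CoatesSujatha2005, statement (A)] [cite: Miller2011LMS, §1 and Def. 1.1] -/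
theorem addPotMultNST_bsdp_two_of_conjA_of_lower
    (hNST2 : Kato2004.rankZero_padicValNat_sha_add_padicValNat_tamagawa_le_at_two_of_noSplitTwistNegOneNegTwo_of_irreducible_of_fineSelmerDual_fg)
    (hGZK : rank_eq_analyticRank_of_analyticRank_le_one) (hmod : hasEntireLFunction_rat)
    (hLim2 : Lim2017.thm35_at_two_fineSelmerDual_moduleFinite_of_classicalMuVanishes_of_le_divisionField_four)
    (hFW : ferreroWashington1979_classicalMuVanishes)
    (hAnaM : ∀ (W : WeierstrassCurve ℚ) [W.IsElliptic] [W.IsGloballyMinimal], ¬ W.HasCM → W.analyticRank = 0 →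
      Addv W 2 → padicValRat 2 W.j < 0 →
      (∀ d : ℚ, d = -1 ∨ d = -2 → ¬ (W.quadraticTwist d).HasSplitMultiplicativeReductionAtPrime 2) →
      W.HasIrreducibleModPGaloisRep 2 → ¬ IsAbelianGalois ℚ (W.divisionField 2) →
      ∀ (κ : ZpExtension ℚ 2), κ.IsCyclotomic →
        ∃ (γ : Field.absoluteGaloisGroup ℚ) (D : W.FineSelmerDualData κ γ),
          Module.Finite ℤ_[2] (RestrictScalars ℤ_[2] (IwasawaAlgebra 2) D.X))
    (hLowM : ∀ (W : WeierstrassCurve ℚ) [W.IsElliptic] [W.IsGloballyMinimal], ¬ W.HasCM → W.analyticRank = 0 →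
      Addv W 2 → padicValRat 2 W.j < 0 →
      (∀ d : ℚ, d = -1 ∨ d = -2 → ¬ (W.quadraticTwist d).HasSplitMultiplicativeReductionAtPrime 2) →
      W.HasIrreducibleModPGaloisRep 2 → MissingLowerBoundAt W 2) :
    ∀ (W : WeierstrassCurve ℚ) [W.IsElliptic] [W.IsGloballyMinimal], ¬ W.HasCM → W.analyticRank = 0 →
      Addv W 2 → padicValRat 2 W.j < 0 →
      (∀ d : ℚ, d = -1 ∨ d = -2 → ¬ (W.quadraticTwist d).HasSplitMultiplicativeReductionAtPrime 2) →
      W.HasIrreducibleModPGaloisRep 2 → BSDp W 2 := by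
  intro W _ _ hcm hr hadd hj hnst hirr
  have hr1 : W.analyticRank ≤ 1 := by rw [hr]; exact zero_le_one
  exact bsdp_of_missingPPartAt W 2 hGZK hr1
    (missingPPartAt_of_lower_of_upper W 2 (hLowM W hcm hr hadd hj hnst hirr)
      (addPotMultNST_upper_two_of_conjA hNST2 hGZK hmod hLim2 hFW hAnaM W hcm hr hadd hj hnst hirr))

end Summit.BirchSwinnertonDyer.BirchSwinnertonDyer.Theorems.AddKatoTwo

end
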